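import Summits.ABC.IUTFork.LanaEtaEvaluation
import Summits.ABC.IUTFork.LanaEtaTemperedKappa
import HarnessLib

/-!
# [IUTchIII] Cor. 3.12 cone — NON-VACUITY of the two LANA `η`-signature records `EtaEvalSide` and `EtaTemperedSide`

PROOF-ONLY support file of the abc-iut cell (wave-5 prover seat abc-iut-w5-d114, gen 3; ADJUDICATION-SPEC §4 (iii)
register, C312 column — the two remaining substantive zero-producer rows of this seat's kernel inhabitation census of
`Summits.ABC.IUTFork` at 06:5xZ, with 18 resp. 8 kernel consumers). TAKES NO SIDE on [IUTchIII] Cor. 3.12.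
NO `def` / `instance` / `structure` / notation: every witness is built inside a theorem term.

The records are abc-iut-c312-4's typings of LANA's Fig. 3 (§6.2 pp. 33–36, the `η`-algorithm Steps 2–6)
[cite: LANA2026Report, §6.2 pp. 33–36]: `EtaEvalSide E` over an [EtTh] §1 datum `E : D.EtaleThetaData`
(`LanaEtaEvaluation`, gen 3; kept by `LanaEtaEvaluationAnchored` p422290) and `EtaTemperedSide X` over a tempered curve
of layer L3 (`LanaEtaTemperedKappa`). The L-LANA lineage's LIVE signature is now `EtaLimSide` (`LanaEtaLim`, p424629, with
its own model witness `EtaLimSide.ofDoubleUnderline`); the two older records are witnessed here so that the theorems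
quantifying over them (`toEtaSteps_phiProd_injective`, `toEtaSteps_containment_iff_factors`, …) are about inhabited types.

* `EtaEvalSide.nonempty` — for EVERY `E`: DEGENERATE witness (empty label type, `∞θ := ⊤`, trivial theta monoid
  `M^{Θ,Frob} := 1`, `Λ^{ext}`-side := the REAL `H¹(Π^tp_Ÿ, Δ_Θ)` with `rgd := id`).
* `EtaEvalSide.exists_oneLabel` — for every `E` and every `K̈`-rational non-cuspidal point `y`: a ONE-LABEL witness with
  `y_t := y` (theta value slot `1`), at which LANA's `φ_v` is injective (c312-4's `toEtaSteps_phiProd_injective`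
  instantiated) and `Containment ⟺ Factors`.
* `EtaTemperedSide.nonempty` — for EVERY tempered curve `X`: DEGENERATE witness (empty labels, all cohomology slots `1`).
* `EtaTemperedSide.exists_oneLabel` — for every `X` and closed point `x`: ONE-LABEL DIAGONAL witness (every cohomology
  slot := the REAL `∞H¹(D_x, Λ(ℚ̄_p^×))`, `res := id`, `sync := id`, `θ`-slots empty/trivial), again with `φ_v` injective.

Honest label: DEGENERATE / DIAGONAL models — joint satisfiability of the typed fields, nothing about the genuine
mono-theta side. [claim: Mochizuki2012, status: disputed] for the quoted IUT context; typed ≠ proved; instantiated ≠ endorsed.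
-/

noncomputable section

namespace Summit.ABC
namespace IUTFork

open Literature.AnabelianGeometry.EtaleTheta Literature.AnabelianGeometry.SemiGraphs

variable {p : ℕ} [Fact p.Prime]

/-! ## 1. `EtaEvalSide` ([EtTh] §1 level) -/

namespace EtaEvalSide

/-- DEGENERATE witness of LANA's Fig. 3 record over an [EtTh] §1 datum: NO labels (`T := ∅`), `∞θ := ⊤`, trivial theta
monoid, `∞H¹(Π_{v,Ÿ}, Λ^{ext}) :=` the real `H¹(Π^tp_Ÿ, Δ_Θ)` with `Θ-Λ-rgd := id`. For EVERY `E`.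
[cite: LANA2026Report, §6.2 pp. 33–36] -/
theorem nonempty {D : ThetaSetting p} (E : D.EtaleThetaData) : Nonempty (EtaEvalSide E) :=
  ⟨{ thetaInf := ⊤
     thetaClasses_subset := fun x _ => Submonoid.mem_top x
     MFrob := PUnit
     H1Yext := D.H1 D.GtpYdd
     kum := 1
     rgd := MulEquiv.refl _
     T := PEmpty
     pts := fun t => nomatch t
     qPow := fun t => nomatch t }⟩

/-- ONE-LABEL witness at a given `K̈`-rational non-cuspidal point `y` (label type `PUnit`, `y_t := y`, theta value slot `1`,
`∞θ := ⊤`, trivial theta monoid): it exists, and AT IT LANA's `φ_v = ∏_t φ_{v,t}` is injective and `Containment ⟺ Factors`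
(abc-iut-c312-4's theorems, instantiated). [cite: LANA2026Report, §6.2 (g) p. 35] -/
theorem exists_oneLabel {D : ThetaSetting p} (E : D.EtaleThetaData)
    (y : ThetaSetting.NonCuspidalPoint E.toKummerData) :
    ∃ S : EtaEvalSide E, S.T = PUnit ∧ (∀ t, S.pts t = y) ∧ Function.Injective S.toEtaSteps.phiProd ∧
      (S.toEtaSteps.Containment ↔ S.toEtaSteps.Factors) :=
  let S : EtaEvalSide E :=
    { thetaInf := ⊤
      thetaClasses_subset := fun x _ => Submonoid.mem_top x
      MFrob := PUnit
      H1Yext := D.H1 D.GtpYdd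
      kum := 1
      rgd := MulEquiv.refl _
      T := PUnit
      pts := fun _ => y
      qPow := fun _ => 1 }
  ⟨S, rfl, fun _ => rfl, S.toEtaSteps_phiProd_injective, S.toEtaSteps_containment_iff_factors⟩

end EtaEvalSide

/-! ## 2. `EtaTemperedSide` (tempered curve of layer L3) -/

namespace EtaTemperedSide

/-- DEGENERATE witness of LANA's Fig. 3 record over a tempered curve: NO labels, every cohomology slot the trivial group,
`θ(Π_v) := ∅`, `∞θ := 1`. For EVERY `X`. [cite: LANA2026Report, §6.2 pp. 33–36] -/
theorem nonempty (X : TemperedCurve p) : Nonempty (EtaTemperedSide X) :=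
  ⟨{ H1Y := PUnit
     thetaClasses := ∅
     thetaInf := ⊥
     unitsEt := ⊥
     thetaClasses_subset := Set.empty_subset _
     MFrob := PUnit
     H1Yext := PUnit
     kum := 1
     rgd := MulEquiv.refl _
     T := PEmpty
     pt := fun t => nomatch t
     H1D := fun t => nomatch t
     instH1D := fun t => nomatch t
     res := fun t => nomatch t
     sync := fun t => nomatch t
     qPow := fun t => nomatch t }⟩

/-- ONE-LABEL DIAGONAL witness at a closed point `x` of `X̄_K`: label type `PUnit`, `x_t := x`, and EVERY cohomology slot
`∞H¹(Π_{v,Ÿ}, ·)`, `∞H¹(D_t, ·)`, `∞H¹(Π_{v,Ÿ}, Λ^{ext})` := the REAL `∞H¹(D_x, Λ(ℚ̄_p^×))` of the tower Kummer theory, with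
`res := id`, `(ι_t)_* := id`, `Θ-Λ-rgd := id`, trivial theta monoid, `θ := ∅`, theta value slot `1`; AT IT `φ_v` is
injective (c312-4's `toEtaSteps_phiProd_injective`, no hypothesis) and `Containment ⟺ Factors`.
[cite: LANA2026Report, §6.2 (f)(g) pp. 35–36] -/
theorem exists_oneLabel (X : TemperedCurve p) (x : X.Pt) :
    ∃ E : EtaTemperedSide X, E.T = PUnit ∧ (∀ t, E.pt t = x) ∧ Function.Injective E.toEtaSteps.phiProd ∧
      (E.toEtaSteps.Containment ↔ E.toEtaSteps.Factors) :=
  let E : EtaTemperedSide X :=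
    { H1Y := Multiplicative (Ambient.H1Tower (TemperedCurveRef.rhoDecomp X x))
      thetaClasses := ∅
      thetaInf := ⊥
      unitsEt := ⊥
      thetaClasses_subset := Set.empty_subset _
      MFrob := PUnit
      H1Yext := Multiplicative (Ambient.H1Tower (TemperedCurveRef.rhoDecomp X x))
      kum := 1
      rgd := MulEquiv.refl _
      T := PUnit
      pt := fun _ => x
      H1D := fun _ => Multiplicative (Ambient.H1Tower (TemperedCurveRef.rhoDecomp X x))
      res := fun _ => MonoidHom.id _
      sync := fun _ => MulEquiv.refl _
      qPow := fun _ => 1 }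
  ⟨E, rfl, fun _ => rfl, E.toEtaSteps_phiProd_injective, E.toEtaSteps_containment_iff_factors⟩

end EtaTemperedSide

end IUTFork
end Summit.ABC

end
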